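import Mathlib.LinearAlgebra.Matrix.Polynomial
import Literature.Computability.AlgebraicComplexity.LMR13DualVarieties
import Literature.Computability.AlgebraicComplexity.MS2001ClassVarieties
import HarnessLib

/-!
# Landsberg–Manivel–Ressayre 2013, Proposition 3.5.1, first assertion — PROVED:
# the boundary form `P_Λ = det_n(A,…,A,S)` lies in `\overline{GL_{n²} · det_n}`

Second proofs sibling of `Literature/Computability/AlgebraicComplexity/LMR13DualVarieties.lean`
(cell `val-lit`, typer `val-lit-t11`). Honest framing: typed literature; VP ≠ VNP is NOT proved and
nothing here is progress on it.

Printed proof (J. M. Landsberg, L. Manivel, N. Ressayre, Comment. Math. Helv. 88 (2013), p. 481,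
`paper:galaxy-pdf-8572435590081880720 p0013.txt:L3–7`; arXiv:1004.4802 `p0008.txt:L65–74`): "The first
assertion is clear: for `t ≠ 0`, one can define an invertible endomorphism `u_t` of `M_n(ℂ)` by
`u_t(A + S) = A + tS`, where `A` and `S` are the skew-symmetric and symmetric parts of a matrix `M`.
Since the determinant of a skew-symmetric matrix of odd size vanishes,
`(u_t · det_n)(M) = det_n(A + tS) = n t det_n(A,…,A,S) + O(t²)`, and therefore `u_t · [det_n]`
converges to `[P_Λ]` when `t` goes to zero."

Formalised on affine cones, following the print: the polynomial family
`F(t) = det_n(A + tS)/(n t) = ∑_{k ≥ 1} t^{k−1} c_k / n` (`c_k` = the `t^k`-coefficient of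
`det_n(A + tS)`, `c_0 = det_n(A) = 0` for `n` odd — `det_skewPartMatrix_eq_zero`) lies, for every
`t ≠ 0`, in the endomorphism orbit `End(W) · det_n` (the substitution `u_t` composed with the scaling
of the first row by `1/(nt)`, `map_eval_pLambdaFamily_mem_endOrbit`), hence in the orbit closure
(`endOrbit_subset_orbitClosure_holds`); its value at `t = 0` is `c_1 / n = (1/n) tr(adj(A) · S) = P_Λ`
by **Jacobi's formula** `[t¹] det(A + tB) = tr(adj(A) · B)` (`coeff_det_X_smul_add_C_one`, proved
here for every commutative ring — Mathlib has the case `A = 1`, `Matrix.coeff_det_one_add_X_smul_one`),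
and the specialisation at `t = 0` of a one-parameter polynomial family of points of a set lies in
its Zariski closure (`coeffVec_map_eval_zero_mem_zariskiClosure_of_family`, `MS2001ClassVarieties.lean`).

Main results: `coeff_det_X_smul_add_C_one` (Jacobi), `det_skewPartMatrix_eq_zero` (odd size),
`pLambda_mem_orbitClosure_detPoly` = **Prop. 3.5.1, first assertion** (`n` odd):
`pLambda n ∈ orbitClosure (detPoly (Fin n) ℂ)` — i.e. `\overline{dc}(P_{Λ,n}) ≤ n`
(`hasBorderDetReprOf_pLambda`). The remaining assertions of Prop. 3.5.1 (codimension-one boundary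
component, `P_Λ ∉ End(W)·det_n`, `dc(P_{Λ,n}) > n`) stay in the named fact `LMR2013_prop_3_5_1`.

## References

* [LandsbergManivelRessayre2013] Comment. Math. Helv. 88 (2013) 469–484, Prop. 3.5.1 (p. 481).
* [MulmuleySohoni2001] SIAM J. Comput. 31 (2001), §4.2 (limits of orbit points lie in `Δ[f]`).
-/

noncomputable section

open MvPolynomial Matrix

namespace Literature.Computability.AlgebraicComplexity

/-! ### Jacobi's formula: the linear coefficient of `det (t • S + A)` -/

section Jacobi

variable {R : Type*} [CommRing R] {m : Type*} [Fintype m] [DecidableEq m]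

/-- Cofactor expansion of a determinant with one row replaced:
`det (A with row i := b) = ∑_j adj(A)_{j i} b_j`. [folklore] -/
private theorem det_updateRow_eq_sum_adjugate (A : Matrix m m R) (i : m) (b : m → R) :
    (A.updateRow i b).det = ∑ j, A.adjugate j i * b j := by
  rw [← Matrix.cramer_transpose_apply, Matrix.cramer_eq_adjugate_mulVec, ← Matrix.adjugate_transpose]
  simp [Matrix.mulVec, dotProduct, Matrix.transpose_apply]

/-- **Jacobi's formula** (linear term): for square matrices `S, A` over a commutative ring, the
coefficient of `t` in `det (t • S + A)` is `tr(adj(A) · S)`. (Mathlib: the case `A = 1`,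
`Matrix.coeff_det_one_add_X_smul_one`; the printed use: "`det_n(A + tS) = n t det_n(A,…,A,S) + O(t²)`",
LMR 2013, proof of Prop. 3.5.1, p. 481.) [cite: LandsbergManivelRessayre2013, Proposition 3.5.1, proof (p. 481)] -/
theorem coeff_det_X_smul_add_C_one (S A : Matrix m m R) :
    (det ((Polynomial.X : Polynomial R) • S.map Polynomial.C + A.map Polynomial.C)).coeff 1 =
      (A.adjugate * S).trace := by
  classical
  simp only [det]
  let D := (detRowAlternating : (m → Polynomial R) [⋀^m]→ₗ[Polynomial R] Polynomial R)
  change (D (fun i => ((Polynomial.X : Polynomial R) • S.map Polynomial.C) i +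
    (A.map Polynomial.C) i)).coeff 1 = _
  conv_lhs => rw [show (fun i ↦ ((Polynomial.X : Polynomial R) • S.map Polynomial.C) i +
      (A.map Polynomial.C) i) =
      (fun i => ((Polynomial.X : Polynomial R) • S.map Polynomial.C) i) +
        (fun i => (A.map Polynomial.C) i) from rfl]
  conv_lhs => rw [D.map_add_univ]
  have h_map : ∀ s : Finset m,
      (s.piecewise (fun i ↦ (S.map Polynomial.C) i) (fun i ↦ (A.map Polynomial.C) i) :
        Matrix m m (Polynomial R)) = Matrix.map (s.piecewise S A) Polynomial.C := by
    intro s; ext i j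
    simp only [Finset.piecewise, Matrix.map_apply]
    split_ifs <;> simp
  have h_det : ∀ s : Finset m,
      D (s.piecewise (fun i ↦ (S.map Polynomial.C) i) (fun i ↦ (A.map Polynomial.C) i)) =
        Polynomial.C (det (s.piecewise S A)) := by
    intro s; change det _ = _
    rw [h_map]; exact (RingHom.map_det Polynomial.C _).symm
  calc (∑ s : Finset m, D (Finset.piecewise s
          (fun i ↦ ((Polynomial.X : Polynomial R) • S.map Polynomial.C) i)
          (fun i ↦ (A.map Polynomial.C) i))).coeff 1
      _ = (∑ s : Finset m, (Polynomial.X : Polynomial R) ^ s.card •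
            D (s.piecewise (fun i ↦ (S.map Polynomial.C) i)
              (fun i ↦ (A.map Polynomial.C) i))).coeff 1 := by
        congr 2 with s
        have h_smul : s.piecewise (fun i ↦ ((Polynomial.X : Polynomial R) • S.map Polynomial.C) i)
            (fun i ↦ (A.map Polynomial.C) i) =
            fun i => (if i ∈ s then (Polynomial.X : Polynomial R) else 1) •
              s.piecewise (fun i ↦ (S.map Polynomial.C) i) (fun i ↦ (A.map Polynomial.C) i) i := by
          funext i j
          simp only [Finset.piecewise, Pi.smul_apply, smul_eq_mul, ite_mul, one_mul]
          split_ifs <;> rfl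
        rw [h_smul, D.map_smul_univ]
        congr 1
        simp only [Finset.prod_ite_mem, Finset.univ_inter, Finset.prod_const]
      _ = ∑ s : Finset m, ((Polynomial.X : Polynomial R) ^ s.card •
            D (Finset.piecewise s (fun i ↦ (S.map Polynomial.C) i)
              (fun i ↦ (A.map Polynomial.C) i))).coeff 1 := by
        simp only [Polynomial.finsetSum_coeff]
      _ = ∑ s ∈ (Finset.univ : Finset m).powersetCard 1, det (s.piecewise S A) := by
        simp_rw [h_det, smul_eq_mul, mul_comm (Polynomial.X ^ _) (Polynomial.C _)]
        simp_rw [Polynomial.C_mul_X_pow_eq_monomial, Polynomial.coeff_monomial]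
        rw [← Finset.sum_filter]
        have h_set : Finset.univ.filter (fun s : Finset m => s.card = 1) =
            Finset.univ.powersetCard 1 := by
          ext s; simp [Finset.mem_powersetCard]
        rw [h_set]
      _ = ∑ i : m, det (A.updateRow i (S i)) := by
        rw [Finset.powersetCard_one, Finset.sum_map]
        refine Finset.sum_congr rfl fun i _ => ?_
        congr 1
        change Finset.piecewise {i} S A = Function.update A i (S i)
        exact Finset.piecewise_singleton _ _ i
      _ = (A.adjugate * S).trace := by
        simp only [det_updateRow_eq_sum_adjugate, Matrix.trace, Matrix.diag, Matrix.mul_apply]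
        rw [Finset.sum_comm]

end Jacobi

/-! ### The skew-symmetric part has zero determinant in odd size -/

section Skew

/-- The skew-symmetric part is skew-symmetric: `Aᵀ = −A`. [cite: LandsbergManivelRessayre2013, §3.5 (p. 480)] -/
theorem skewPartMatrix_transpose (n : ℕ) : (skewPartMatrix n)ᵀ = -skewPartMatrix n := by
  ext i j
  simp only [skewPartMatrix, Matrix.transpose_apply, Matrix.of_apply, Matrix.neg_apply]
  ring

/-- "The determinant of a skew-symmetric matrix of odd size vanishes" (LMR 2013, p. 481,
`paper:galaxy-pdf-8572435590081880720 p0013.txt:L3`): `det A = 0` for the skew part `A` of the generic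
matrix of odd size. [cite: LandsbergManivelRessayre2013, Proposition 3.5.1, proof (p. 481)] -/
theorem det_skewPartMatrix_eq_zero {n : ℕ} (hn : Odd n) : (skewPartMatrix n).det = 0 := by
  have h := congrArg Matrix.det (skewPartMatrix_transpose n)
  rw [Matrix.det_transpose, Matrix.det_neg, Fintype.card_fin, hn.neg_one_pow, neg_one_mul] at h
  have h2 : (2 : MvPolynomial (Fin n × Fin n) ℂ) * (skewPartMatrix n).det = 0 := by
    rw [two_mul]
    nth_rw 2 [h]
    exact add_neg_cancel _
  exact (mul_eq_zero.mp h2).resolve_left two_ne_zero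

end Skew

/-! ### The one-parameter family `det_n(A + tS)/(nt)` -/

section Family

variable (n : ℕ)

/-- `det_n(A + tS)` as a polynomial in `t` with coefficients forms on `M_n`:
`det (X • S.map C + A.map C)`. [cite: LandsbergManivelRessayre2013, Proposition 3.5.1, proof (p. 481)] -/
def detSkewPlusTSym : Polynomial (MvPolynomial (Fin n × Fin n) ℂ) :=
  det ((Polynomial.X : Polynomial (MvPolynomial (Fin n × Fin n) ℂ)) • (symPartMatrix n).map Polynomial.C
    + (skewPartMatrix n).map Polynomial.C)

/-- The family `F(t) = ∑_{k < n} t^k c_{k+1} / n` (`c_k` the `t^k`-coefficient of `det_n(A + tS)`), a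
polynomial in the matrix variables with coefficients in `ℂ[t]`; for `t ≠ 0` it is `det_n(A+tS)/(nt)`,
at `t = 0` it is `c_1/n = P_Λ`. [cite: LandsbergManivelRessayre2013, Proposition 3.5.1, proof (p. 481)] -/
def pLambdaFamily : MvPolynomial (Fin n × Fin n) (Polynomial ℂ) :=
  ∑ k ∈ Finset.range n,
    C (Polynomial.C (1 / (n : ℂ)) * Polynomial.X ^ k) *
      map (Polynomial.C : ℂ →+* Polynomial ℂ) ((detSkewPlusTSym n).coeff (k + 1))

/-- Specialising the family at `t`: `F(t) = ∑_{k<n} (t^k/n) c_{k+1}`.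
[cite: LandsbergManivelRessayre2013, Proposition 3.5.1, proof (p. 481)] -/
theorem map_eval_pLambdaFamily (t : ℂ) :
    map (Polynomial.evalRingHom t) (pLambdaFamily n) =
      ∑ k ∈ Finset.range n, C (1 / (n : ℂ) * t ^ k) * (detSkewPlusTSym n).coeff (k + 1) := by
  simp only [pLambdaFamily, map_sum, map_mul, map_C]
  refine Finset.sum_congr rfl fun k _ => ?_
  have hcomp : (Polynomial.evalRingHom t).comp (Polynomial.C : ℂ →+* Polynomial ℂ) = RingHom.id ℂ := by
    ext a; simp
  rw [MvPolynomial.map_map, hcomp, MvPolynomial.map_id]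
  simp [Polynomial.coe_evalRingHom]

/-- At `t = 0` the family is `P_Λ = (1/n) tr(adj(A) S)` (Jacobi's formula), for `n ≥ 1`.
[cite: LandsbergManivelRessayre2013, Proposition 3.5.1, proof (p. 481)] -/
theorem map_eval_zero_pLambdaFamily (hn : 0 < n) :
    map (Polynomial.evalRingHom 0) (pLambdaFamily n) = pLambda n := by
  rw [map_eval_pLambdaFamily]
  obtain ⟨n', rfl⟩ : ∃ n', n = n' + 1 := ⟨n - 1, by omega⟩
  rw [Finset.sum_range_succ', Finset.sum_eq_zero fun k _ => by simp, zero_add, pow_zero, mul_one,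
    zero_add, detSkewPlusTSym, coeff_det_X_smul_add_C_one, pLambda]

/-- The substitution `u_t` (`M ↦ A + tS`, i.e. `X_{ij} ↦ ((1+t)/2) X_{ij} + ((t−1)/2) X_{ji}`) followed
by the scaling of the first row by `c`, as a matrix of `linSubst`.
[cite: LandsbergManivelRessayre2013, Proposition 3.5.1, proof (p. 481)] -/
def uSubstMatrix [NeZero n] (t c : ℂ) : Matrix (Fin n × Fin n) (Fin n × Fin n) ℂ :=
  fun q p => (if p.1 = 0 then c else 1) *
    ((if q = p then (1 + t) / 2 else 0) + (if q = p.swap then (t - 1) / 2 else 0))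

/-- The substituted variables: `X_{(i,j)} ↦ c_i · (((1+t)/2) X_{ij} + ((t−1)/2) X_{ji})` with `c_0 = c`,
`c_i = 1` otherwise. [cite: LandsbergManivelRessayre2013, Proposition 3.5.1, proof (p. 481)] -/
theorem linSubst_uSubstMatrix_X [NeZero n] (t c : ℂ) (p : Fin n × Fin n) :
    linSubst (Fin n × Fin n) ℂ (uSubstMatrix n t c) (X p) =
      C (if p.1 = 0 then c else 1) *
        (C ((1 + t) / 2) * X p + C ((t - 1) / 2) * X p.swap) := by
  classical
  rw [linSubst_X]
  simp only [uSubstMatrix]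
  have hsplit : ∀ q : Fin n × Fin n,
      ((if p.1 = 0 then c else 1) * ((if q = p then (1 + t) / 2 else 0) +
        (if q = p.swap then (t - 1) / 2 else 0))) • (X q : MvPolynomial (Fin n × Fin n) ℂ) =
      (if q = p then ((if p.1 = 0 then c else 1) * ((1 + t) / 2)) • X q else 0) +
        (if q = p.swap then ((if p.1 = 0 then c else 1) * ((t - 1) / 2)) • X q else 0) := by
    intro q
    split_ifs <;> simp [add_smul, mul_add]
  simp_rw [hsplit]
  rw [Finset.sum_add_distrib, Finset.sum_ite_eq' Finset.univ p, Finset.sum_ite_eq' Finset.univ p.swap]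
  simp only [Finset.mem_univ, if_true, smul_eq_C_mul, C_mul]
  ring

/-- `u_t` composed with the first-row scaling by `c` sends `det_n` to `c · det_n(A + tS)`.
[cite: LandsbergManivelRessayre2013, Proposition 3.5.1, proof (p. 481)] -/
theorem linSubst_uSubstMatrix_detPoly [NeZero n] (t c : ℂ) :
    linSubst (Fin n × Fin n) ℂ (uSubstMatrix n t c) (detPoly (Fin n) ℂ) =
      C c * det ((C t : MvPolynomial (Fin n × Fin n) ℂ) • symPartMatrix n + skewPartMatrix n) := by
  classical
  rw [detPoly, AlgHom.map_det, AlgHom.mapMatrix_apply]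
  have hM : (Matrix.mvPolynomialX (Fin n) (Fin n) ℂ).map (linSubst (Fin n × Fin n) ℂ (uSubstMatrix n t c))
      = Matrix.of fun i j => (if i = 0 then C c else 1) *
          ((C t : MvPolynomial (Fin n × Fin n) ℂ) • symPartMatrix n + skewPartMatrix n) i j := by
    ext i j
    have e1 : (C ((1 + t) / 2) : MvPolynomial (Fin n × Fin n) ℂ) = (1 + C t) * C (1 / 2) := by
      rw [show (1 + t) / 2 = (1 + t) * (1 / 2) by ring, map_mul, map_add, map_one]
    have e2 : (C ((t - 1) / 2) : MvPolynomial (Fin n × Fin n) ℂ) = (C t - 1) * C (1 / 2) := by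
      rw [show (t - 1) / 2 = (t - 1) * (1 / 2) by ring, map_mul, map_sub, map_one]
    simp only [Matrix.map_apply, Matrix.mvPolynomialX_apply, linSubst_uSubstMatrix_X, Prod.swap_prod_mk,
      Matrix.of_apply, Matrix.add_apply, Matrix.smul_apply, symPartMatrix, skewPartMatrix, smul_eq_mul,
      e1, e2]
    split_ifs with h
    · ring
    · rw [map_one]; ring
  rw [hM, Matrix.det_mul_column]
  congr 1
  rw [Finset.prod_eq_single (0 : Fin n)]
  · simp
  · intro i _ hi; simp [hi]
  · simp

/-- Evaluating `det_n(A + tS)` (a polynomial in `t` over the forms) at the constant `t`: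
`∑_k c_k t^k = det (C t • S + A)`. [cite: LandsbergManivelRessayre2013, Proposition 3.5.1, proof (p. 481)] -/
theorem eval_C_detSkewPlusTSym (t : ℂ) :
    (detSkewPlusTSym n).eval (C t) =
      det ((C t : MvPolynomial (Fin n × Fin n) ℂ) • symPartMatrix n + skewPartMatrix n) := by
  rw [detSkewPlusTSym, ← Polynomial.coe_evalRingHom, RingHom.map_det, RingHom.mapMatrix_apply]
  congr 1
  ext i j
  simp only [Matrix.map_apply, Matrix.add_apply, Matrix.smul_apply, smul_eq_mul,
    Polynomial.coe_evalRingHom, Polynomial.eval_add, Polynomial.eval_mul, Polynomial.eval_X,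
    Polynomial.eval_C]

/-- For `t ≠ 0` and `n` odd, `F(t) = det_n(A + tS)/(nt)` is the image of `det_n` under a linear
substitution, hence lies in the endomorphism orbit `End(W) · det_n`.
[cite: LandsbergManivelRessayre2013, Proposition 3.5.1, proof (p. 481)] -/
theorem map_eval_pLambdaFamily_mem_endOrbit {n : ℕ} (hn : Odd n) {t : ℂ} (ht : t ≠ 0) :
    map (Polynomial.evalRingHom t) (pLambdaFamily n) ∈
      endOrbit (Fin n × Fin n) ℂ (detPoly (Fin n) ℂ) := by
  classical
  haveI : NeZero n := ⟨by rintro rfl; exact (Nat.not_odd_zero hn).elim⟩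
  have hn0 : (n : ℂ) ≠ 0 := Nat.cast_ne_zero.mpr (NeZero.ne n)
  refine ⟨uSubstMatrix n t (1 / ((n : ℂ) * t)), ?_⟩
  change linSubst (Fin n × Fin n) ℂ (uSubstMatrix n t (1 / ((n : ℂ) * t))) (detPoly (Fin n) ℂ) = _
  rw [linSubst_uSubstMatrix_detPoly, ← eval_C_detSkewPlusTSym, map_eval_pLambdaFamily]
  -- expand `eval (C t)` as the sum of coefficients
  have hdeg : (detSkewPlusTSym n).natDegree < n + 1 := by
    have h := Polynomial.natDegree_det_X_add_C_le (symPartMatrix n) (skewPartMatrix n)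
    rw [Fintype.card_fin] at h
    exact Nat.lt_succ_of_le h
  have h0 : (detSkewPlusTSym n).coeff 0 = 0 := by
    rw [detSkewPlusTSym, Polynomial.coeff_det_X_add_C_zero]
    exact det_skewPartMatrix_eq_zero hn
  rw [Polynomial.eval_eq_sum_range' hdeg, Finset.sum_range_succ', h0, zero_mul, add_zero,
    Finset.mul_sum]
  refine Finset.sum_congr rfl fun k _ => ?_
  rw [← mul_assoc, mul_right_comm, ← map_pow, ← map_mul]
  congr 1
  congr 1
  field_simp
  ring

/-- **Landsberg–Manivel–Ressayre 2013, Proposition 3.5.1, first assertion — PROVED**: for `n` odd,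
"the polynomial `P_Λ` belongs to the orbit closure of the determinant":
`pLambda n ∈ \overline{GL_{n²} · det_n}` (the tree's `orbitClosure`, affine cone). Proof as printed
(`u_t(A + S) = A + tS`, `det_n(A + tS) = nt P_Λ + O(t²)`, let `t → 0`), on the polynomial family
`pLambdaFamily` via `coeffVec_map_eval_zero_mem_zariskiClosure_of_family` and
`endOrbit_subset_orbitClosure_holds`. [cite: LandsbergManivelRessayre2013, Proposition 3.5.1 (p. 481)] -/
theorem pLambda_mem_orbitClosure_detPoly {n : ℕ} (hn : Odd n) :
    pLambda n ∈ orbitClosure (detPoly (Fin n) ℂ) := by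
  classical
  have hn0 : 0 < n := hn.pos
  have hfam := coeffVec_map_eval_zero_mem_zariskiClosure_of_family
    (endOrbit (Fin n × Fin n) ℂ (detPoly (Fin n) ℂ)) (pLambdaFamily n)
    (fun t ht => map_eval_pLambdaFamily_mem_endOrbit hn ht)
  rw [map_eval_zero_pLambdaFamily n hn0] at hfam
  -- `End · det_n ⊆ Δ[det_n]`, and `Δ[det_n]` is Zariski closed in coefficient space
  have hsub : coeffVec '' endOrbit (Fin n × Fin n) ℂ (detPoly (Fin n) ℂ) ⊆
      zariskiClosure (coeffVec '' glOrbit (Fin n × Fin n) ℂ (detPoly (Fin n) ℂ)) := by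
    rintro _ ⟨h, hh, rfl⟩
    exact endOrbit_subset_orbitClosure_holds _ hh
  have := zariskiClosure_mono hsub hfam
  rw [zariskiClosure_zariskiClosure] at this
  exact this

/-- Hence `\overline{dc}(P_{Λ,n}) ≤ n`: `HasBorderDetReprOf (pLambda n) n n` (no padding; identity
placement). [cite: LandsbergManivelRessayre2013, Proposition 3.5.1 (p. 481)] -/
theorem hasBorderDetReprOf_pLambda {n : ℕ} (hn : Odd n) : HasBorderDetReprOf (pLambda n) n n := by
  haveI : NeZero n := ⟨by rintro rfl; exact (Nat.not_odd_zero hn).elim⟩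
  refine ⟨Function.Embedding.refl _, (0, 0), fun h => (lt_irrefl n h).elim, ?_⟩
  have : padForm (Function.Embedding.refl (Fin n × Fin n)) ((0 : Fin n), (0 : Fin n)) n n (pLambda n)
      = pLambda n := by
    rw [padForm_self]
    exact MvPolynomial.rename_id_apply _
  rw [this]
  exact pLambda_mem_orbitClosure_detPoly hn

/-- And `\overline{dc}(P_{Λ,n}) ≤ n` in `sInf` form. [cite: LandsbergManivelRessayre2013, Proposition 3.5.1 (p. 481)] -/
theorem borderDc_pLambda_le {n : ℕ} (hn : Odd n) : borderDc (pLambda n) n ≤ n :=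
  Nat.sInf_le ⟨le_rfl, hasBorderDetReprOf_pLambda hn⟩

/-- `m ≤ \overline{dc}(P)` as soon as `P` (of degree `m`) has some border determinantal expression:
the sizes in the definition of `\overline{dc}` start at `m` (LMR 2013 §1.1, "the smallest `n` such
that `[ℓ^{n−m}P] ∈ 𝒟et_n`", `paper:arxiv-1004.4802 p0003.txt:L22–27`).
[cite: LandsbergManivelRessayre2013, §1.1 (p. 470)] -/
theorem le_borderDc_of_hasBorderDetReprOf {k : Type*} [Field k] {σ : Type*} {P : MvPolynomial σ k}
    {m N : ℕ} (hmN : m ≤ N) (h : HasBorderDetReprOf P m N) : m ≤ borderDc P m :=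
  le_csInf ⟨N, hmN, h⟩ fun _ hN' => hN'.1

/-- **LMR 2013, Prop. 3.5.1: `\overline{dc}(P_{Λ,n}) = n`** (`n` odd) — the fifth conjunct of the
typed `LMR2013_prop_3_5_1` PROVED: `≤ n` is `borderDc_pLambda_le` (the first assertion
`P_Λ ∈ \overline{GL·det_n}`), `≥ n` holds by definition of `\overline{dc}` for a form of degree `n`
("`\overline{dc}(P_Λ) = n`", journal p. 481, `paper:galaxy-pdf-8572435590081880720 p0013.txt:L1`; arXiv
`p0008.txt:L60–64`). The strict inequality `n < dc(P_Λ)` and conjuncts (b)–(d) stay in the named fact.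
[cite: LandsbergManivelRessayre2013, Proposition 3.5.1 (p. 481)] -/
theorem borderDc_pLambda {n : ℕ} (hn : Odd n) : borderDc (pLambda n) n = n :=
  le_antisymm (borderDc_pLambda_le hn)
    (le_borderDc_of_hasBorderDetReprOf le_rfl (hasBorderDetReprOf_pLambda hn))

end Family

end Literature.Computability.AlgebraicComplexity
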